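import Literature.Barriers.CriticalPhenomena.PlaquetteWalkHoleRootChirality
import Literature.Probability.RandomPlanarGeometry.YangBaxterSAWHexDictionaryWinding
import HarnessLib

/-!
# Barrier catalogue (SAWScalingLimit): WALKS FROM FACE PATHS — a parametric walk constructor with its index calculus («FACE PATHS»)

`Z → ∞` limit model of the printed Yang–Baxter weights [GlazmanManolescu2019, §1, eq. (1)]; the «RECTANGLE COEFFICIENT» line of the venture lane «pcv-sawmu»
(b-engine-1 g27). The lane's existence witnesses (root-row law `PlaquetteWalkHoleRootRowLawWitness`, column law `PlaquetteWalkHoleRootColumnLawWitness`) are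
kernel-decided one cell at a time; to state the laws for EVERY cell of the quadrant the witnesses must be PARAMETRIC. This file turns a face path — faces
`φ 0, …, φ (n−1)` pairwise distinct, entered through `σ i` and left through `τ i ≠ σ i`, consecutive ones glued (`(φ i).side (τ i) = (φ (i+1)).side (σ (i+1))`),
and no exit side equal to the initial mid-edge — into a walk (`YBWalk.ofFacePath`, on top of `YBWalk.ofFn`), and computes its index data: `fc i = φ i`, `sIn i = σ i`,
`sOut i = τ i`, `nth`, the plaquette map is injective, so NO plaquette is doubly visited and the LIMIT COST is the number of turning arcs plus `1 − slotDeg`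
(`cost_ofFacePath`), and the first hit of a rhombus is the first index whose mid-edge is one of its sides (`firstHitG_eq_of_nth`).
[GlazmanManolescu2019 §1 (definition of the model), Fig. 1, eq. (1); Glazman2015WeightedSAW Lemma 3.1 (proof, pp. 6–7)]
-/

noncomputable section

open Set Function Complex

namespace Literature.Probability.RandomPlanarGeometry.SAW.YangBaxter

open Real
open Literature.Barriers.CriticalPhenomena.PlaquetteWalk

namespace YBWalk

variable {D : Set Face} {a z : MidEdge}

/-! ## §1 The constructor -/

section FacePath

variable (n : ℕ) (φ : ℕ → Face) (σ τ : ℕ → Side)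

/-- The mid-edges of a face path: the entry side of the first face, then the exit sides. [cite: GlazmanManolescu2019, §1 (definition of the model)] -/
def pathMid (φ : ℕ → Face) (σ τ : ℕ → Side) (i : ℕ) : MidEdge := if i = 0 then (φ 0).side (σ 0) else (φ (i - 1)).side (τ (i - 1))

variable {n φ σ τ}

/-- Under gluing, the `i`-th mid-edge of a face path is the entry side of the `i`-th face. [cite: GlazmanManolescu2019, §1 (definition of the model)] -/
theorem pathMid_eq_side_in (hglue : ∀ i, i + 1 < n → (φ i).side (τ i) = (φ (i + 1)).side (σ (i + 1))) {i : ℕ} (hi : i < n) :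
    pathMid φ σ τ i = (φ i).side (σ i) := by
  unfold pathMid
  split_ifs with h
  · subst h; rfl
  · obtain ⟨j, rfl⟩ : ∃ j, i = j + 1 := ⟨i - 1, by omega⟩
    simpa using hglue j (by omega)

/-- The `(i+1)`-st mid-edge of a face path is the exit side of the `i`-th face. [cite: GlazmanManolescu2019, §1 (definition of the model)] -/
theorem pathMid_succ (i : ℕ) : pathMid φ σ τ (i + 1) = (φ i).side (τ i) := by
  simp [pathMid]

/-- The first mid-edge of a face path is the entry side of the first face. [cite: GlazmanManolescu2019, §1 (definition of the model)] -/
theorem pathMid_zero : pathMid φ σ τ 0 = (φ 0).side (σ 0) := by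
  simp [pathMid]

/-- ★ **THE MID-EDGES OF A FACE PATH ARE PAIRWISE DISTINCT** as soon as the faces are pairwise distinct, glued, entered and left through different sides, and no
exit side is the initial mid-edge: a mid-edge borders only two faces, and an exit mid-edge borders the face it leaves and the next face.
[cite: GlazmanManolescu2019, §1 (the lattice of rhombi and its mid-edges)] -/
theorem pathMid_injective (hio : ∀ i < n, σ i ≠ τ i) (hglue : ∀ i, i + 1 < n → (φ i).side (τ i) = (φ (i + 1)).side (σ (i + 1)))
    (hφ : ∀ i j, i < n → j < n → φ i = φ j → i = j) (h0 : ∀ j < n, (φ j).side (τ j) ≠ (φ 0).side (σ 0)) :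
    ∀ i j, i ≤ n → j ≤ n → pathMid φ σ τ i = pathMid φ σ τ j → i = j := by
  -- the exit mid-edges are pairwise distinct
  have hexit : ∀ i j, i < j → j < n → (φ i).side (τ i) ≠ (φ j).side (τ j) := by
    intro i j hij hj h
    have hne : φ i ≠ φ j := fun e => absurd (hφ i j (by omega) hj e) (by omega)
    have hg : (φ i).side (τ i) = (φ (i + 1)).side (σ (i + 1)) := hglue i (by omega)
    have hne' : φ (i + 1) ≠ φ i := fun e => absurd (hφ (i + 1) i (by omega) (by omega) e) (by omega)
    have h1 := (Face.exists_side_eq_iff (φ i) ((φ i).side (τ i))).1 ⟨τ i, rfl⟩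
    have h2 := (Face.exists_side_eq_iff (φ j) ((φ i).side (τ i))).1 ⟨τ j, h.symm⟩
    have h3 := (Face.exists_side_eq_iff (φ (i + 1)) ((φ i).side (τ i))).1 ⟨σ (i + 1), hg.symm⟩
    have h13 : φ (i + 1) = φ j := by
      rcases h1 with h1 | h1 <;> rcases h2 with h2 | h2 <;> rcases h3 with h3 | h3
      all_goals first | exact absurd (h1.trans h2.symm) hne | exact absurd (h3.trans h1.symm) hne' | exact h3.trans h2.symm
    have hj' : i + 1 = j := hφ (i + 1) j (by omega) hj h13
    subst hj'
    exact hio (i + 1) hj (Face.side_injective _ (hg.symm.trans h))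
  intro i j hi hj h
  rcases Nat.eq_zero_or_pos i with rfl | hi0 <;> rcases Nat.eq_zero_or_pos j with rfl | hj0
  · rfl
  · obtain ⟨j', rfl⟩ : ∃ j', j = j' + 1 := ⟨j - 1, by omega⟩
    rw [pathMid_succ, pathMid_zero] at h; exact absurd h.symm (h0 j' (by omega))
  · obtain ⟨i', rfl⟩ : ∃ i', i = i' + 1 := ⟨i - 1, by omega⟩
    rw [pathMid_succ, pathMid_zero] at h; exact absurd h (h0 i' (by omega))
  · obtain ⟨i', rfl⟩ : ∃ i', i = i' + 1 := ⟨i - 1, by omega⟩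
    obtain ⟨j', rfl⟩ : ∃ j', j = j' + 1 := ⟨j - 1, by omega⟩
    rw [pathMid_succ, pathMid_succ] at h
    rcases lt_trichotomy i' j' with hlt | heq | hgt
    · exact absurd h (hexit i' j' hlt (by omega))
    · rw [heq]
    · exact absurd h.symm (hexit j' i' hgt (by omega))

/-- The arcs of a glued face path lie in its faces. [cite: GlazmanManolescu2019, §1 (definition of the model)] -/
theorem arcFace_pathMid (hio : ∀ i < n, σ i ≠ τ i) (hglue : ∀ i, i + 1 < n → (φ i).side (τ i) = (φ (i + 1)).side (σ (i + 1))) {i : ℕ} (hi : i < n) :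
    arcFace (pathMid φ σ τ i, pathMid φ σ τ (i + 1)) = some (φ i) := by
  rw [pathMid_eq_side_in hglue hi, pathMid_succ]
  exact arcFace_side_side _ _ _ (hio i hi)

/-- ★ **THE WALK OF A FACE PATH**: `n ≥ 1` pairwise distinct faces of `D`, entry sides `σ`, exit sides `τ ≠ σ`, glued consecutively, no exit side being the initial
mid-edge, form a walk from the entry side of the first face to the exit side of the last. [cite: GlazmanManolescu2019, §1 (definition of the model), Fig. 1] -/
def ofFacePath (n : ℕ) (φ : ℕ → Face) (σ τ : ℕ → Side) (hio : ∀ i < n, σ i ≠ τ i)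
    (hglue : ∀ i, i + 1 < n → (φ i).side (τ i) = (φ (i + 1)).side (σ (i + 1)))
    (hφ : ∀ i j, i < n → j < n → φ i = φ j → i = j) (hD : ∀ i < n, φ i ∈ D)
    (h0 : ∀ j < n, (φ j).side (τ j) ≠ (φ 0).side (σ 0)) :
    YBWalk D (pathMid φ σ τ 0) (pathMid φ σ τ n) :=
  ofFn n (pathMid φ σ τ) (pathMid_injective hio hglue hφ h0) (fun i hi => ⟨φ i, hD i hi, arcFace_pathMid hio hglue hi⟩)
    (fun i hi => by
      rw [arcFace_pathMid hio hglue (by omega), arcFace_pathMid hio hglue hi, Ne, Option.some.injEq]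
      intro h; exact absurd (hφ i (i + 1) (by omega) hi h) (by omega))
    (fun i j hi hj f hWE hSN => by
      have hfi : φ i = f := by
        have h1 := arcFace_pathMid hio hglue hi
        rcases hWE with e | e <;> rw [e, arcFace_side_side _ _ _ (by decide)] at h1 <;> exact (Option.some.inj h1).symm
      have hfj : φ j = f := by
        have h1 := arcFace_pathMid hio hglue hj
        rcases hSN with e | e <;> rw [e, arcFace_side_side _ _ _ (by decide)] at h1 <;> exact (Option.some.inj h1).symm
      have hij : i = j := hφ i j hi hj (hfi.trans hfj.symm)
      subst hij
      rcases hWE with e | e <;> rcases hSN with e' | e' <;>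
        · have := (Prod.mk.inj (e.symm.trans e')).1
          exact absurd (Face.side_injective f this) (by decide))

variable (hio : ∀ i < n, σ i ≠ τ i) (hglue : ∀ i, i + 1 < n → (φ i).side (τ i) = (φ (i + 1)).side (σ (i + 1)))
  (hφ : ∀ i j, i < n → j < n → φ i = φ j → i = j) (hD : ∀ i < n, φ i ∈ D)
  (h0 : ∀ j < n, (φ j).side (τ j) ≠ (φ 0).side (σ 0))

/-! ## §2 Index calculus -/

/-- The mid-edges of the walk of a face path. [cite: GlazmanManolescu2019, §1 (definition of the model)] -/
theorem ofFacePath_mids : (ofFacePath n φ σ τ hio hglue hφ hD h0).mids = List.ofFn fun i : Fin (n + 1) => pathMid φ σ τ i := rfl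

/-- The walk of a face path has `n` arcs. [cite: GlazmanManolescu2019, §1 (definition of the model)] -/
theorem ofFacePath_length : (ofFacePath n φ σ τ hio hglue hφ hD h0).arcs.length = n := ofFn_length _ _ _ _

/-- `nth` of the walk of a face path. [cite: GlazmanManolescu2019, §1 (definition of the model)] -/
theorem ofFacePath_nth {i : ℕ} (hi : i ≤ n) : (ofFacePath n φ σ τ hio hglue hφ hD h0).nth i = pathMid φ σ τ i := ofFn_nth _ _ _ _ hi

/-- ★ The plaquette map and the sides of the walk of a face path: `fc i = φ i`, `sIn i = σ i`, `sOut i = τ i`. [cite: GlazmanManolescu2019, §1, Fig. 1 and Fig. 2] -/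
theorem ofFacePath_fc_sIn_sOut {i : ℕ} (hi : i < n) :
    (ofFacePath n φ σ τ hio hglue hφ hD h0).fc i = φ i ∧ (ofFacePath n φ σ τ hio hglue hφ hD h0).sIn i = σ i ∧
      (ofFacePath n φ σ τ hio hglue hφ hD h0).sOut i = τ i := by
  set γ := ofFacePath n φ σ τ hio hglue hφ hD h0 with hγ
  have hi' : i < γ.arcs.length := by rw [ofFacePath_length]; exact hi
  have hfa := (γ.arcFace_arcAt hi').1
  rw [γ.arcAt_eq_nth hi', ofFacePath_nth _ _ _ _ _ hi.le, ofFacePath_nth _ _ _ _ _ (by omega), arcFace_pathMid hio hglue hi,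
    Option.some.injEq] at hfa
  obtain ⟨h1, h2⟩ := γ.side_sIn_eq_nth hi'
  rw [ofFacePath_nth _ _ _ _ _ hi.le, pathMid_eq_side_in hglue hi, ← hfa] at h1
  rw [ofFacePath_nth _ _ _ _ _ (by omega), pathMid_succ, ← hfa] at h2
  exact ⟨hfa.symm, Face.side_injective _ h1, Face.side_injective _ h2⟩

/-- The plaquette map of the walk of a face path is injective: no plaquette is doubly visited. [cite: GlazmanManolescu2019, §1, Fig. 1 (the configurations `w₁`, `w₂`)] -/
theorem ofFacePath_fc_injective : ∀ i j, i < (ofFacePath n φ σ τ hio hglue hφ hD h0).arcs.length → j < (ofFacePath n φ σ τ hio hglue hφ hD h0).arcs.length →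
    (ofFacePath n φ σ τ hio hglue hφ hD h0).fc i = (ofFacePath n φ σ τ hio hglue hφ hD h0).fc j → i = j := by
  intro i j hi hj h
  rw [ofFacePath_length] at hi hj
  rw [(ofFacePath_fc_sIn_sOut hio hglue hφ hD h0 hi).1, (ofFacePath_fc_sIn_sOut hio hglue hφ hD h0 hj).1] at h
  exact hφ i j hi hj h

/-- The arcs of the walk of a face path, as a list over the indices. [cite: GlazmanManolescu2019, §1 (definition of the model)] -/
theorem ofFacePath_arcs : (ofFacePath n φ σ τ hio hglue hφ hD h0).arcs = (List.range n).map fun i => (pathMid φ σ τ i, pathMid φ σ τ (i + 1)) := by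
  set γ := ofFacePath n φ σ τ hio hglue hφ hD h0 with hγ
  have hl : γ.arcs.length = n := ofFacePath_length _ _ _ _ _
  refine List.ext_getElem (by rw [hl, List.length_map, List.length_range]) fun i h1 h2 => ?_
  have hi : i < n := by rw [List.length_map, List.length_range] at h2; exact h2
  rw [γ.arcs_getElem_eq_nth h1, List.getElem_map, List.getElem_range, ofFacePath_nth _ _ _ _ _ hi.le, ofFacePath_nth _ _ _ _ _ (by omega)]

/-- ★ **THE TURNING ARCS OF A FACE PATH**: the number of turning arcs of the walk is the number of indices `i < n` with `arcKind (σ i) (τ i) ≠ straight`.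
[cite: GlazmanManolescu2019, §1, Fig. 1 and eq. (1)] -/
theorem ofFacePath_countP_turn : (ofFacePath n φ σ τ hio hglue hφ hD h0).arcs.countP (fun p => qTurnOf p ≠ 0) =
    (List.range n).countP fun i => arcKind (σ i) (τ i) ≠ .straight := by
  set γ := ofFacePath n φ σ τ hio hglue hφ hD h0 with hγ
  have hl : γ.arcs.length = n := ofFacePath_length _ _ _ _ _
  have key : ∀ i < n, (decide (qTurnOf (pathMid φ σ τ i, pathMid φ σ τ (i + 1)) ≠ 0)) = decide (arcKind (σ i) (τ i) ≠ .straight) := by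
    intro i hi
    have hi' : i < γ.arcs.length := by rw [hl]; exact hi
    have hmem : (pathMid φ σ τ i, pathMid φ σ τ (i + 1)) ∈ γ.arcs := by
      rw [ofFacePath_arcs]; exact List.mem_map.2 ⟨i, List.mem_range.2 hi, rfl⟩
    have hk := (γ.arcKindOf_getElem hi').2
    have eget : γ.arcs[i] = (pathMid φ σ τ i, pathMid φ σ τ (i + 1)) := by
      rw [γ.arcs_getElem_eq_nth hi', ofFacePath_nth _ _ _ _ _ hi.le, ofFacePath_nth _ _ _ _ _ (by omega)]
    obtain ⟨-, h2, h3⟩ := ofFacePath_fc_sIn_sOut hio hglue hφ hD h0 hi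
    rw [eget, h2, h3] at hk
    have hiff := γ.qTurnOf_ne_zero_iff_kind hmem
    rw [hk] at hiff
    simp only [Option.some.injEq] at hiff
    have hnd : arcKind (σ i) (τ i) ≠ .degen := by
      have := hio i hi; revert this; cases σ i <;> cases τ i <;> decide
    have hq : qTurnOf (pathMid φ σ τ i, pathMid φ σ τ (i + 1)) ≠ 0 ↔ arcKind (σ i) (τ i) ≠ .straight := by
      rw [hiff]; revert hnd; cases arcKind (σ i) (τ i) <;> simp
    rw [decide_eq_decide]; exact hq
  rw [ofFacePath_arcs, List.countP_map]
  refine List.countP_congr fun i hi => ?_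
  show decide (qTurnOf (pathMid φ σ τ i, pathMid φ σ τ (i + 1)) ≠ 0) = true ↔ _
  rw [key i (List.mem_range.1 hi)]

/-- ★★ **THE LIMIT COST OF A FACE PATH**: with no doubly visited plaquette, the limit cost at slot `s` is the number of turning arcs plus `1 − slotDeg s`.
[cite: GlazmanManolescu2019, §1, Fig. 1 and eq. (1); Remark 2.2] [cite: Glazman2015WeightedSAW, Lemma 3.1 (proof, pp. 6–7)] -/
theorem cost_ofFacePath (s : Fin 4) : cost s (ofFacePath n φ σ τ hio hglue hφ hD h0).mids =
    ((List.range n).countP fun i => arcKind (σ i) (τ i) ≠ .straight) + (1 - slotDeg s) := by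
  set γ := ofFacePath n φ σ τ hio hglue hφ hD h0 with hγ
  have h1 := γ.turns_eq_isolated_add_two_pairs
  obtain ⟨h2, h3⟩ := γ.pairs_eq_zero_of_injective (ofFacePath_fc_injective hio hglue hφ hD h0)
  rw [h2, h3, ofFacePath_countP_turn] at h1
  unfold cost; omega

/-- ★ **THE FIRST HIT OF A FACE PATH**: if the mid-edge `m` is a side of `r` and no earlier mid-edge is, the first hit of `r` is `m`. [cite: Glazman2015WeightedSAW, Lemma 3.1 (proof, pp. 6–7)] -/
theorem firstHitG_eq_of_nth {r : Face} {sE : Side} (γ : YBWalk D a (r.side sE)) {m : ℕ} (hm : m ≤ γ.arcs.length) {s : Side} (hs : γ.nth m = r.side s)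
    (hlt : ∀ i < m, ∀ t : Side, γ.nth i ≠ r.side t) : γ.firstHitG = m := by
  unfold firstHitG
  refine le_antisymm (Finset.min'_le _ _ ((γ.mem_hitIdx r).2 ⟨hm, s, hs⟩)) (Finset.le_min' _ _ _ fun i hi => ?_)
  obtain ⟨-, t, ht⟩ := (γ.mem_hitIdx r).1 hi
  by_contra h
  exact hlt i (by omega) t ht

end FacePath

/-! ## §3 Transport along `YBWalk.cast` -/

section Cast

variable {a' z' : MidEdge}

/-- `cast` does not change `nth`. [cite: GlazmanManolescu2019, §1 (definition of the model: walks as sequences of mid-edges)] -/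
theorem cast_nth (γ : YBWalk D a z) (ha : a = a') (hz : z = z') (i : ℕ) : (γ.cast ha hz).nth i = γ.nth i := by
  subst ha hz; rfl

/-- `cast` does not change the arcs. [cite: GlazmanManolescu2019, §1 (definition of the model: walks as sequences of mid-edges)] -/
theorem cast_arcs (γ : YBWalk D a z) (ha : a = a') (hz : z = z') : (γ.cast ha hz).arcs = γ.arcs := by
  subst ha hz; rfl

/-- `cast` does not change the plaquette map and the sides. [cite: GlazmanManolescu2019, §1, Fig. 1 and Fig. 2 (plaquettes and sides of the arcs)] -/
theorem cast_fc_sIn_sOut (γ : YBWalk D a z) (ha : a = a') (hz : z = z') (i : ℕ) :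
    (γ.cast ha hz).fc i = γ.fc i ∧ (γ.cast ha hz).sIn i = γ.sIn i ∧ (γ.cast ha hz).sOut i = γ.sOut i := by
  subst ha hz; exact ⟨rfl, rfl, rfl⟩

end Cast

/-- A list count over `List.range` as the cardinality of a filtered `Finset.range` (used to count the turning arcs of a face path).
[cite: GlazmanManolescu2019, §1, eq. (1) (lane plumbing)] -/
theorem countP_range_eq_card (n : ℕ) (p : ℕ → Prop) [DecidablePred p] :
    (List.range n).countP (fun i => decide (p i)) = ((Finset.range n).filter p).card := by
  induction n with
  | zero => simp
  | succ n ih =>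
    rw [List.range_succ, List.countP_append, ih, Finset.range_add_one, Finset.filter_insert]
    by_cases h : p n
    · rw [if_pos h, Finset.card_insert_of_notMem (by simp)]; simp [h]
    · rw [if_neg h]; simp [h]

end YBWalk

end Literature.Probability.RandomPlanarGeometry.SAW.YangBaxter
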